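import Summits.MatrixMultiplication.MatrixMultiplication.Theorems.ObstructionDescentUniversalOccurrenceTwoRectangleBlowUpGadget

set_option linter.dupNamespace false
set_option autoImplicit false

/-!
# Obstruction descent — universal occurrence: blow-up determinants of direct sums and the crossed design (K34)

Lens-3 node g45, second half of the storey dictionary (first half: `…TwoRectangleBlowUpGadget` = K33).
The blow-up determinant `F_X(t) = det(∑_l X_l ⊗ T_l)` of the two-rectangle sector is MULTIPLICATIVE under
direct sums along the first two legs (common third leg), so the determinant of a STOREYED design
`t = s ⊕ diag(γ)` — a `2 × 2 × n` block `s` on the rows/columns `{0,1}` plus a diagonal tail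
`∑_{i} e_i ⊗ e_i ⊗ e_{γ i}` — factors as (block gadget) × `∏_i det X_{γ i}`.  Consequences proved here,
sorry-free and `def`-free, over any commutative ring:

* `blowUp_det_directSum` — `det(∑ X_l ⊗ (M₁,l ⊕ M₂,l)) = det(∑ X_l ⊗ M₁,l) · det(∑ X_l ⊗ M₂,l)`
  (any block size `δ`, any index types);
* `blowUp_diagDesign_det`, `blowUp_diagDesign_det_transpose` — the FLOOR (storey 0): for the diagonal
  design `diag(γ)` the blow-up determinant is `∏_i det X_{γ i}` and is symmetric under blockwise
  transposition `X_l ↦ X_lᵀ` (no four-odd part: the floor law of K23/K26, read in the dictionary);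
* `blowUp_triangularDesign_det_transpose` — STOREY ONE: a block with an empty slot `(1,0)` (one lifted
  letter, the aligned lifts of NODE-g44 §4) has `det[[A,B],[0,D]] = det A det D`, so the whole design is
  still symmetric — one storey never produces a four-odd type;
* `blowUp_crossedDesign_det` — STOREY TWO, the crossed design `s× ⊕ diag(γ)` (`s×(i,j,·) = e_{c i j}`):
  `det = det[[X_{c₀₀},X_{c₀₁}],[X_{c₁₀},X_{c₁₁}]] · ∏_i det X_{γ i}`;
* `blowUp_crossedDesign_det_sub_det_transpose` — its antisymmetric part is
  `Δ(X_{c₀₀},X_{c₀₁},X_{c₁₀},X_{c₁₁}) · ∏_i det X_{γ i}` (the storey-two formula of the node, verified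
  numerically for `N ≤ 7` before being proved here in general);
* `blowUp_crossedDesign_asymmetric` — if the four block letters are pairwise distinct then for EVERY tail `γ`
  (repeated letters allowed — the tail realises the multiplicities `μ` of the target type `ν = 2μ + (1⁴)`)
  some tuple `X` separates `X` from `Xᵀ`; witness `X_{c₀₀} = 1, X_{c₀₁} = [[1,1],[0,1]], X_{c₁₀} = [[1,0],[1,1]],
  X_{c₁₁} = [[2,1],[1,1]]`, all other `X_l = 1`, for which the antisymmetric part is `−1`;
* `blowUp_crossedDesign_symmetric_of_eq` — a repeated block letter makes the design symmetric
  (the null designs `γ(N) = γ(N+1)` of NODE-g44).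

In the dictionary of NODE-g45 (Goodman–Wallach Thm 5.7.3: `ℂ[q]` even types only, `Δ·ℂ[q]` exactly the
four-odd types) these say: rank-`N` and one-storey designs carry no four-odd type, and the crossed design of
rank `N + 2` carries EVERY four-odd type `((2^N),(2^N),2μ+(1⁴))` — the `+2` threshold of the census
(I245/I249) and the universal occurrence of the four-odd classes (K29–K32 are its first instances).
References: Goodman–Wallach Thm 5.7.3; Bürgisser–Ikenmeyer 2011 Lemma 6.1 / Remark 6.2;
Bürgisser–Christandl–Ikenmeyer 2011 (Kronecker feasibility of two-row-rectangle triples); Domokos–Zubkov 2001.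
-/

namespace Summit.MatrixMultiplication.MatrixMultiplication.Theorems.ObstructionCalculus

open Matrix BigOperators
open scoped Kronecker
open Literature.Barriers.Langlands.Endoscopy (det_fin_four)

section DirectSum

variable {R : Type*} [CommRing R]

/-- **Multiplicativity of blow-up determinants under direct sums.**  For slice families `M₁, M₂` (square,
any index types) and a tuple `X` of `δ × δ` matrices,
`det(∑_l X_l ⊗ (M₁ l ⊕ M₂ l)) = det(∑_l X_l ⊗ M₁ l) · det(∑_l X_l ⊗ M₂ l)`. [folklore] -/
theorem blowUp_det_directSum {ι₁ ι₂ : Type*} [Fintype ι₁] [Fintype ι₂] [DecidableEq ι₁] [DecidableEq ι₂]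
    {δ n : ℕ} (X : Fin n → Matrix (Fin δ) (Fin δ) R) (M₁ : Fin n → Matrix ι₁ ι₁ R)
    (M₂ : Fin n → Matrix ι₂ ι₂ R) :
    (∑ l, X l ⊗ₖ Matrix.fromBlocks (M₁ l) 0 0 (M₂ l)).det =
      (∑ l, X l ⊗ₖ M₁ l).det * (∑ l, X l ⊗ₖ M₂ l).det := by
  have h : Matrix.reindex (Equiv.prodSumDistrib (Fin δ) ι₁ ι₂) (Equiv.prodSumDistrib (Fin δ) ι₁ ι₂)
      (∑ l, X l ⊗ₖ Matrix.fromBlocks (M₁ l) 0 0 (M₂ l)) =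
      Matrix.fromBlocks (∑ l, X l ⊗ₖ M₁ l) 0 0 (∑ l, X l ⊗ₖ M₂ l) := by
    ext (⟨a, i⟩ | ⟨a, i⟩) (⟨b, j⟩ | ⟨b, j⟩) <;>
      simp [Matrix.reindex_apply, Matrix.submatrix_apply, Matrix.sum_apply, Matrix.kroneckerMap_apply]
  rw [← Matrix.det_reindex_self (Equiv.prodSumDistrib (Fin δ) ι₁ ι₂), h, Matrix.det_fromBlocks_zero₂₁]

/-- **The floor (storey 0).**  For the diagonal design `diag(γ) = ∑_i e_i ⊗ e_i ⊗ e_{γ i}` the blow-up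
determinant is `∏_i det X_{γ i}`. [this node; cf. K25 `det_sum_kronecker_diagSlice`] -/
theorem blowUp_diagDesign_det {δ N n : ℕ} (X : Fin n → Matrix (Fin δ) (Fin δ) R) (γ : Fin N → Fin n) :
    (∑ l, X l ⊗ₖ Matrix.of (fun i j : Fin N => if i = j ∧ l = γ i then (1 : R) else 0)).det =
      ∏ i, (X (γ i)).det := by
  have hdiag : ∀ l, Matrix.of (fun i j : Fin N => if i = j ∧ l = γ i then (1 : R) else 0) =
      diagonal (fun i => if l = γ i then (1 : R) else 0) := by
    intro l
    ext i j
    by_cases hij : i = j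
    · subst hij; simp
    · simp [hij, diagonal_apply_ne]
  simp_rw [hdiag, kronecker_diagonal]
  have hsum : ∑ l, blockDiagonal (fun i => MulOpposite.op (if l = γ i then (1 : R) else 0) • X l) =
      blockDiagonal (fun i => X (γ i)) := by
    ext ⟨a, i⟩ ⟨b, j⟩
    simp only [Matrix.sum_apply, blockDiagonal_apply', Matrix.smul_apply, MulOpposite.smul_eq_mul_unop,
      MulOpposite.unop_op]
    split_ifs with hij
    · rw [Finset.sum_eq_single (γ i)]
      · simp
      · intro l _ hl; simp [hl]
      · simp
    · simp
  rw [hsum, det_blockDiagonal]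

/-- The floor is symmetric under blockwise transposition `X_l ↦ X_lᵀ` (in the dictionary: rank-`N` points
carry no four-odd type — the floor law). [this node] -/
theorem blowUp_diagDesign_det_transpose {δ N n : ℕ} (X : Fin n → Matrix (Fin δ) (Fin δ) R)
    (γ : Fin N → Fin n) :
    (∑ l, (X l)ᵀ ⊗ₖ Matrix.of (fun i j : Fin N => if i = j ∧ l = γ i then (1 : R) else 0)).det =
      (∑ l, X l ⊗ₖ Matrix.of (fun i j : Fin N => if i = j ∧ l = γ i then (1 : R) else 0)).det := by
  rw [blowUp_diagDesign_det (fun l => (X l)ᵀ) γ, blowUp_diagDesign_det X γ]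
  exact Finset.prod_congr rfl fun i _ => Matrix.det_transpose _

end DirectSum

section Storeys

variable {R : Type*} [CommRing R] {N n : ℕ}

/-- **Storey one is symmetric.**  The triangular block `s▹` with letters `c i j` on the slots
`(0,0), (0,1), (1,1)` and an EMPTY slot `(1,0)` (one lifted letter over a diagonal pair) has blow-up
determinant `det X_{c₀₀} · det X_{c₁₁}`; hence the design `s▹ ⊕ diag(γ)` is symmetric under blockwise
transposition — in the dictionary: one storey never produces a four-odd type. [this node] -/
theorem blowUp_triangularDesign_det_transpose (X : Fin n → Matrix (Fin 2) (Fin 2) R)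
    (c : Fin 2 → Fin 2 → Fin n) (γ : Fin N → Fin n) :
    (∑ l, (X l)ᵀ ⊗ₖ Matrix.fromBlocks
        (Matrix.of (fun i j : Fin 2 => if l = c i j ∧ ¬ (i = 1 ∧ j = 0) then (1 : R) else 0)) 0 0
        (Matrix.of (fun i j : Fin N => if i = j ∧ l = γ i then (1 : R) else 0))).det =
      (∑ l, X l ⊗ₖ Matrix.fromBlocks
        (Matrix.of (fun i j : Fin 2 => if l = c i j ∧ ¬ (i = 1 ∧ j = 0) then (1 : R) else 0)) 0 0
        (Matrix.of (fun i j : Fin N => if i = j ∧ l = γ i then (1 : R) else 0))).det := by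
  -- the triangular block alone
  have hblock : ∀ Z : Fin n → Matrix (Fin 2) (Fin 2) R,
      (∑ l, Z l ⊗ₖ Matrix.of (fun i j : Fin 2 => if l = c i j ∧ ¬ (i = 1 ∧ j = 0) then (1 : R) else 0)).det
        = (Z (c 0 0)).det * (Z (c 1 1)).det := by
    intro Z
    have hY : ∀ (i j : Fin 2), ¬ (i = 1 ∧ j = 0) →
        (∑ l, (if l = c i j ∧ ¬ (i = 1 ∧ j = 0) then (1 : R) else 0) • Z l) = Z (c i j) := by
      intro i j hij
      rw [Finset.sum_eq_single (c i j)]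
      · simp [hij]
      · intro l _ hl; simp [hl]
      · simp
    have hY10 : (∑ l, (if l = c 1 0 ∧ ¬ ((1 : Fin 2) = 1 ∧ (0 : Fin 2) = 0) then (1 : R) else 0) • Z l) = 0 := by
      simp
    rw [blowUp_pencil_two_det Z]
    rw [hY 0 0 (by decide), hY 0 1 (by decide), hY 1 1 (by decide), hY10]
    simp [det_fin_four, Matrix.det_fin_two]
    ring
  rw [blowUp_det_directSum, blowUp_det_directSum, hblock, hblock, blowUp_diagDesign_det_transpose,
    Matrix.det_transpose, Matrix.det_transpose]

/-- **The crossed design (storey two): value.**  For block letters `c : Fin 2 → Fin 2 → Fin n` and tail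
letters `γ : Fin N → Fin n`, the blow-up determinant of `s× ⊕ diag(γ)` is the block gadget of
`(X_{c₀₀}, X_{c₀₁}, X_{c₁₀}, X_{c₁₁})` times `∏_i det X_{γ i}`. [this node] -/
theorem blowUp_crossedDesign_det (X : Fin n → Matrix (Fin 2) (Fin 2) R)
    (c : Fin 2 → Fin 2 → Fin n) (γ : Fin N → Fin n) :
    (∑ l, X l ⊗ₖ Matrix.fromBlocks (Matrix.of (fun i j : Fin 2 => if l = c i j then (1 : R) else 0)) 0 0
        (Matrix.of (fun i j : Fin N => if i = j ∧ l = γ i then (1 : R) else 0))).det =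
      (!![X (c 0 0) 0 0, X (c 0 0) 0 1, X (c 0 1) 0 0, X (c 0 1) 0 1;
          X (c 0 0) 1 0, X (c 0 0) 1 1, X (c 0 1) 1 0, X (c 0 1) 1 1;
          X (c 1 0) 0 0, X (c 1 0) 0 1, X (c 1 1) 0 0, X (c 1 1) 0 1;
          X (c 1 0) 1 0, X (c 1 0) 1 1, X (c 1 1) 1 0, X (c 1 1) 1 1] : Matrix (Fin 4) (Fin 4) R).det *
        ∏ i, (X (γ i)).det := by
  have hY : ∀ (i j : Fin 2), (∑ l, (if l = c i j then (1 : R) else 0) • X l) = X (c i j) := by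
    intro i j
    rw [Finset.sum_eq_single (c i j)]
    · simp
    · intro l _ hl; simp [hl]
    · simp
  rw [blowUp_det_directSum, blowUp_pencil_two_det X, blowUp_diagDesign_det]
  simp only [hY]

/-- **The crossed design (storey two): antisymmetric part** `= Δ(X_{c₀₀},X_{c₀₁},X_{c₁₀},X_{c₁₁}) · ∏_i det X_{γ i}`.
In the dictionary: the four-odd part of the blow-up determinant of `s× ⊕ diag(γ)` is `½ Δ · ∏ det X_{γ i}`,
of `GL(W)`-weight `(1⁴) + 2μ` where `μ` are the multiplicities of the tail letters. [this node] -/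
theorem blowUp_crossedDesign_det_sub_det_transpose (X : Fin n → Matrix (Fin 2) (Fin 2) R)
    (c : Fin 2 → Fin 2 → Fin n) (γ : Fin N → Fin n) :
    (∑ l, X l ⊗ₖ Matrix.fromBlocks (Matrix.of (fun i j : Fin 2 => if l = c i j then (1 : R) else 0)) 0 0
        (Matrix.of (fun i j : Fin N => if i = j ∧ l = γ i then (1 : R) else 0))).det -
      (∑ l, (X l)ᵀ ⊗ₖ Matrix.fromBlocks (Matrix.of (fun i j : Fin 2 => if l = c i j then (1 : R) else 0)) 0 0
        (Matrix.of (fun i j : Fin N => if i = j ∧ l = γ i then (1 : R) else 0))).det =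
      (!![X (c 0 0) 0 0, X (c 0 1) 0 0, X (c 1 0) 0 0, X (c 1 1) 0 0;
          X (c 0 0) 0 1, X (c 0 1) 0 1, X (c 1 0) 0 1, X (c 1 1) 0 1;
          X (c 0 0) 1 0, X (c 0 1) 1 0, X (c 1 0) 1 0, X (c 1 1) 1 0;
          X (c 0 0) 1 1, X (c 0 1) 1 1, X (c 1 0) 1 1, X (c 1 1) 1 1] : Matrix (Fin 4) (Fin 4) R).det *
        ∏ i, (X (γ i)).det := by
  rw [blowUp_crossedDesign_det X c γ, blowUp_crossedDesign_det (fun l => (X l)ᵀ) c γ]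
  have hprod : ∏ i, ((fun l => (X l)ᵀ) (γ i)).det = ∏ i, (X (γ i)).det :=
    Finset.prod_congr rfl fun i _ => Matrix.det_transpose _
  rw [hprod, ← sub_mul, ← blowUp_gadget_det_sub_det_transpose (X (c 0 0)) (X (c 0 1)) (X (c 1 0)) (X (c 1 1))]

/-- **The crossed design is transposition-asymmetric for every tail.**  If the four block letters are
pairwise distinct then, whatever the tail `γ` (repetitions allowed), some tuple `X` has
`det(∑ X_l ⊗ t×_l) ≠ det(∑ X_lᵀ ⊗ t×_l)`: take `X_{c₀₀} = 1`, `X_{c₀₁} = [[1,1],[0,1]]`,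
`X_{c₁₀} = [[1,0],[1,1]]`, `X_{c₁₁} = [[2,1],[1,1]]` and `X_l = 1` otherwise — all of determinant `1`,
with bracket `−1`.  In the dictionary: the blow-up determinant of `s× ⊕ diag(γ)` has a non-zero component
of `GL(W)`-type `2μ + (1⁴)`, `μ` = the letter multiplicities of `γ` — every four-odd two-rectangle type
occurs at rank `N + 2`. [this node] -/
theorem blowUp_crossedDesign_asymmetric [Nontrivial R] (c : Fin 2 → Fin 2 → Fin n)
    (hc : ∀ i j i' j', c i j = c i' j' → i = i' ∧ j = j') (γ : Fin N → Fin n) :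
    ∃ X : Fin n → Matrix (Fin 2) (Fin 2) R,
      (∑ l, X l ⊗ₖ Matrix.fromBlocks (Matrix.of (fun i j : Fin 2 => if l = c i j then (1 : R) else 0)) 0 0
          (Matrix.of (fun i j : Fin N => if i = j ∧ l = γ i then (1 : R) else 0))).det ≠
        (∑ l, (X l)ᵀ ⊗ₖ Matrix.fromBlocks (Matrix.of (fun i j : Fin 2 => if l = c i j then (1 : R) else 0)) 0 0
          (Matrix.of (fun i j : Fin N => if i = j ∧ l = γ i then (1 : R) else 0))).det := by
  classical
  -- the witness
  let W : Fin 2 → Fin 2 → Matrix (Fin 2) (Fin 2) R :=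
    ![![1, !![1, 1; 0, 1]], ![!![1, 0; 1, 1], !![2, 1; 1, 1]]]
  let X : Fin n → Matrix (Fin 2) (Fin 2) R := fun l =>
    if h : ∃ p : Fin 2 × Fin 2, l = c p.1 p.2 then W h.choose.1 h.choose.2 else 1
  have hX : ∀ i j, X (c i j) = W i j := by
    intro i j
    have h : ∃ p : Fin 2 × Fin 2, c i j = c p.1 p.2 := ⟨(i, j), rfl⟩
    simp only [X, dif_pos h]
    obtain ⟨h1, h2⟩ := hc _ _ _ _ h.choose_spec
    rw [← h1, ← h2]
  have hdetW : ∀ i j, (W i j).det = 1 := by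
    intro i j
    fin_cases i <;> fin_cases j <;> norm_num [W, Matrix.det_fin_two]
  have hdetX : ∀ l, (X l).det = 1 := by
    intro l
    by_cases h : ∃ p : Fin 2 × Fin 2, l = c p.1 p.2
    · simp only [X, dif_pos h, hdetW]
    · simp only [X, dif_neg h, Matrix.det_one]
  refine ⟨X, ?_⟩
  intro h
  have h0 := blowUp_crossedDesign_det_sub_det_transpose X c γ
  rw [h, sub_self] at h0
  simp only [hX, hdetX, Finset.prod_const_one, mul_one] at h0
  simp [W, det_fin_four] at h0
  norm_num at h0

/-- **Repeated block letter ⇒ symmetric design.**  If two of the block letters coincide the crossed design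
`s× ⊕ diag(γ)` is symmetric under blockwise transposition, for every tail. [this node] -/
theorem blowUp_crossedDesign_symmetric_of_eq (X : Fin n → Matrix (Fin 2) (Fin 2) R)
    (c : Fin 2 → Fin 2 → Fin n) (h : c 0 1 = c 1 0) (γ : Fin N → Fin n) :
    (∑ l, X l ⊗ₖ Matrix.fromBlocks (Matrix.of (fun i j : Fin 2 => if l = c i j then (1 : R) else 0)) 0 0
        (Matrix.of (fun i j : Fin N => if i = j ∧ l = γ i then (1 : R) else 0))).det =
      (∑ l, (X l)ᵀ ⊗ₖ Matrix.fromBlocks (Matrix.of (fun i j : Fin 2 => if l = c i j then (1 : R) else 0)) 0 0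
        (Matrix.of (fun i j : Fin N => if i = j ∧ l = γ i then (1 : R) else 0))).det := by
  rw [blowUp_det_directSum, blowUp_det_directSum, blowUp_crossedBlock_symmetric_of_eq X c h,
    blowUp_diagDesign_det_transpose]

end Storeys

end Summit.MatrixMultiplication.MatrixMultiplication.Theorems.ObstructionCalculus
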